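import Mathlib.Analysis.InnerProductSpace.PiL2
import Mathlib.Analysis.InnerProductSpace.Projection.Reflection
import HarnessLib

/-!
# The hyperoctahedral (`B_d`) lattice mirror normals

For a finite index type `ι` (the case of interest is `ι = Fin 3`, the cubic lattice `ℤ³ ⊂ ℝ³`)
we define the set `latticeMirrorNormals ι ⊂ EuclideanSpace ℝ ι` of the vectors

  `e_i`, `e_i + e_j`, `e_i - e_j`   (`i ≠ j`, `e_i = EuclideanSpace.single i 1`),

normals of the reflection hyperplanes of the cubic lattice through the origin: the coordinate
planes `x_i = 0` and the diagonal planes `x_i = -x_j`, `x_i = x_j`. For `ι = Fin 3` these are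
`3 + 3 + 6 = 12` vectors defining the NINE mirrors of the `B₃` (hyperoctahedral) arrangement
(`e_i - e_j` and `e_j - e_i` define the same mirror); the corresponding orthogonal reflections
`((ℝ ∙ n)ᗮ).reflection` are the `n²` reflections of the hyperoctahedral group `S_n^B` of signed
permutations [BjornerBrenti2005, §8.1, Prop. 8.1.5]: the sign changes `(i, -i)` (normal `e_i`,
`reflection_single_apply`), the transpositions `(i, j)(-i, -j)` (normal `e_i - e_j`,
`reflection_single_sub_single_apply`) and the signed transpositions `(i, -j)(-i, j)` (normal
`e_i + e_j`, `reflection_single_add_single_apply`) — exactly the three lattice maps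
`x ↦ update x i (-x i)`, `x ↦ x ∘ swap i j`, `x ↦ (x with x_i ↦ -x_j, x_j ↦ -x_i)` of item
`CriticalCorrNineMirrorRP` of route `CriticalPhenomena/Ising3DConformalLimit/HyperoctahedralRP`,
whose items `HRP2Rigidity` / `TwoPointKernelOfLimit` quantify over `n` by the literal defining
formula of `latticeMirrorNormals (Fin 3)` (`mem_latticeMirrorNormals_iff` is `Iff.rfl`).

Main proved fact (the combinatorial input of the route's LOCAL step): for every `k ≠ 0` the
normals NOT orthogonal to `k` span the whole space (`span_latticeMirrorNormals_inner_ne_zero`):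
if `k_i ≠ 0` then `e_i` qualifies, and if `k_i = 0` then, `k_j ≠ 0` for some `j`, both
`e_i ± e_j` qualify and average to `e_i`. (For the three coordinate normals alone this fails at
every `k` with a vanishing coordinate.)

NOT here: the statement that these reflections generate the full hyperoctahedral group as a
subgroup of the isometry group (only the identification of the individual reflections with sign
changes / (signed) transpositions is given), and anything about reflection positivity (see
`Literature.MathematicalPhysics.QuantumFieldTheory.IsMirrorRPKernel`).
-/

noncomputable section

open scoped InnerProductSpace

namespace Literature.MathematicalPhysics.QuantumFieldTheory

variable {ι : Type*} [Fintype ι] [DecidableEq ι]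

/-- **The lattice mirror normals** of the cubic lattice `ℤ^ι ⊂ ℝ^ι` through the origin:
`e_i` (coordinate mirror `x_i = 0`), `e_i + e_j` (diagonal mirror `x_i = -x_j`) and `e_i - e_j`
(diagonal mirror `x_i = x_j`), `i ≠ j`; for `ι = Fin 3` the nine mirrors of the `B₃`
(hyperoctahedral) arrangement, whose reflections are the `n²` reflections `(i,-i)`,
`(i,j)(-i,-j)` of the signed permutation group. Written with `∃ i j, i ≠ j ∧ (_ ∨ _ ∨ _)` exactly
as inlined in route HyperoctahedralRP. [cite: BjornerBrenti2005, §8.1, Prop. 8.1.5] -/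
def latticeMirrorNormals (ι : Type*) [Fintype ι] [DecidableEq ι] : Set (EuclideanSpace ℝ ι) :=
  {n | ∃ i j : ι, i ≠ j ∧ (n = EuclideanSpace.single i 1 ∨
    n = EuclideanSpace.single i 1 + EuclideanSpace.single j 1 ∨
    n = EuclideanSpace.single i 1 - EuclideanSpace.single j 1)}

/-- Unfolding `latticeMirrorNormals` (by `Iff.rfl`). [folklore] -/
theorem mem_latticeMirrorNormals_iff (n : EuclideanSpace ℝ ι) :
    n ∈ latticeMirrorNormals ι ↔ ∃ i j : ι, i ≠ j ∧ (n = EuclideanSpace.single i 1 ∨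
      n = EuclideanSpace.single i 1 + EuclideanSpace.single j 1 ∨
      n = EuclideanSpace.single i 1 - EuclideanSpace.single j 1) :=
  Iff.rfl

/-- Coordinate normals `e_i` are lattice mirror normals (given a second index `j ≠ i`).
[folklore] -/
theorem single_mem_latticeMirrorNormals {i j : ι} (h : i ≠ j) :
    EuclideanSpace.single i (1 : ℝ) ∈ latticeMirrorNormals ι :=
  ⟨i, j, h, Or.inl rfl⟩

/-- Anti-diagonal normals `e_i + e_j`, `i ≠ j`, are lattice mirror normals. [folklore] -/
theorem single_add_single_mem_latticeMirrorNormals {i j : ι} (h : i ≠ j) :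
    EuclideanSpace.single i (1 : ℝ) + EuclideanSpace.single j 1 ∈ latticeMirrorNormals ι :=
  ⟨i, j, h, Or.inr (Or.inl rfl)⟩

/-- Diagonal normals `e_i - e_j`, `i ≠ j`, are lattice mirror normals. [folklore] -/
theorem single_sub_single_mem_latticeMirrorNormals {i j : ι} (h : i ≠ j) :
    EuclideanSpace.single i (1 : ℝ) - EuclideanSpace.single j 1 ∈ latticeMirrorNormals ι :=
  ⟨i, j, h, Or.inr (Or.inr rfl)⟩

/-- There are finitely many lattice mirror normals. [folklore] -/
theorem latticeMirrorNormals_finite : (latticeMirrorNormals ι).Finite := by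
  have h : latticeMirrorNormals ι ⊆
      (Set.range (fun i : ι => EuclideanSpace.single i (1 : ℝ)) ∪
        Set.range (fun p : ι × ι =>
          EuclideanSpace.single p.1 (1 : ℝ) + EuclideanSpace.single p.2 1)) ∪
      Set.range (fun p : ι × ι =>
        EuclideanSpace.single p.1 (1 : ℝ) - EuclideanSpace.single p.2 1) := by
    rintro n ⟨i, j, -, h | h | h⟩
    · exact Or.inl (Or.inl ⟨i, h.symm⟩)
    · exact Or.inl (Or.inr ⟨(i, j), h.symm⟩)
    · exact Or.inr ⟨(i, j), h.symm⟩
  exact (((Set.finite_range _).union (Set.finite_range _)).union (Set.finite_range _)).subset h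

/-- `⟪e_i, k⟫ = k_i`. [folklore] -/
theorem inner_single_one_left (i : ι) (k : EuclideanSpace ℝ ι) :
    ⟪EuclideanSpace.single i (1 : ℝ), k⟫_ℝ = k i := by
  rw [EuclideanSpace.inner_single_left, map_one, one_mul]

/-- `⟪e_i + e_j, k⟫ = k_i + k_j`. [folklore] -/
theorem inner_single_add_single_left (i j : ι) (k : EuclideanSpace ℝ ι) :
    ⟪EuclideanSpace.single i (1 : ℝ) + EuclideanSpace.single j 1, k⟫_ℝ = k i + k j := by
  rw [inner_add_left, inner_single_one_left, inner_single_one_left]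

/-- `⟪e_i - e_j, k⟫ = k_i - k_j`. [folklore] -/
theorem inner_single_sub_single_left (i j : ι) (k : EuclideanSpace ℝ ι) :
    ⟪EuclideanSpace.single i (1 : ℝ) - EuclideanSpace.single j 1, k⟫_ℝ = k i - k j := by
  rw [inner_sub_left, inner_single_one_left, inner_single_one_left]

/-- Lattice mirror normals are nonzero (so they define genuine hyperplane mirrors). [folklore] -/
theorem ne_zero_of_mem_latticeMirrorNormals {n : EuclideanSpace ℝ ι}
    (hn : n ∈ latticeMirrorNormals ι) : n ≠ 0 := by
  obtain ⟨i, j, hij, rfl | rfl | rfl⟩ := hn <;> intro h <;>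
    have h' := congrArg (fun v : EuclideanSpace ℝ ι => v i) h <;>
    simp [hij] at h'

/-- The squared lengths: `‖e_i‖² = 1`, `‖e_i ± e_j‖² = 2`. [folklore] -/
theorem norm_sq_of_mem_latticeMirrorNormals {n : EuclideanSpace ℝ ι}
    (hn : n ∈ latticeMirrorNormals ι) : ‖n‖ ^ 2 = 1 ∨ ‖n‖ ^ 2 = 2 := by
  obtain ⟨i, j, hij, rfl | rfl | rfl⟩ := hn
  · left; simp
  · right
    rw [← real_inner_self_eq_norm_sq, inner_single_add_single_left]
    simp [hij, Ne.symm hij]; norm_num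
  · right
    rw [← real_inner_self_eq_norm_sq, inner_single_sub_single_left]
    simp [hij, Ne.symm hij]; norm_num

/-! ### The reflections are signed permutations of the coordinates -/

/-- The reflection in the coordinate mirror `x_i = 0` (normal `e_i`) is the sign change of the
`i`-th coordinate, the reflection `(i, -i)` of the hyperoctahedral group.
[cite: BjornerBrenti2005, §8.1, Prop. 8.1.5] -/
theorem reflection_single_apply (i : ι) (x : EuclideanSpace ℝ ι) (l : ι) :
    ((ℝ ∙ EuclideanSpace.single i (1 : ℝ))ᗮ.reflection x) l = if l = i then -x l else x l := by
  rw [Submodule.reflection_orthogonal_apply, Submodule.reflection_singleton_apply,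
    inner_single_one_left]
  simp only [RCLike.ofReal_real_eq_id, id_eq, PiLp.norm_single, norm_one, one_pow, div_one,
    PiLp.neg_apply, PiLp.sub_apply, PiLp.smul_apply, PiLp.single_apply, smul_eq_mul, nsmul_eq_mul,
    Nat.cast_ofNat]
  split_ifs with h
  · subst h; ring
  · ring

/-- The reflection in the diagonal mirror `x_i = x_j` (normal `e_i - e_j`, `i ≠ j`) swaps the
coordinates `i` and `j`, the reflection `(i, j)(-i, -j)` of the hyperoctahedral group.
[cite: BjornerBrenti2005, §8.1, Prop. 8.1.5] -/
theorem reflection_single_sub_single_apply {i j : ι} (hij : i ≠ j) (x : EuclideanSpace ℝ ι)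
    (l : ι) :
    ((ℝ ∙ (EuclideanSpace.single i (1 : ℝ) - EuclideanSpace.single j 1))ᗮ.reflection x) l =
      x (Equiv.swap i j l) := by
  have hn : ‖EuclideanSpace.single i (1 : ℝ) - EuclideanSpace.single j 1‖ ^ 2 = 2 := by
    rw [← real_inner_self_eq_norm_sq, inner_single_sub_single_left]
    simp [hij, Ne.symm hij]; norm_num
  rw [Submodule.reflection_orthogonal_apply, Submodule.reflection_singleton_apply,
    inner_single_sub_single_left]
  simp only [RCLike.ofReal_real_eq_id, id_eq, hn, PiLp.neg_apply, PiLp.sub_apply, PiLp.smul_apply,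
    PiLp.single_apply, smul_eq_mul, nsmul_eq_mul, Nat.cast_ofNat]
  by_cases hli : l = i
  · simp [hli, hij, Equiv.swap_apply_left]; ring
  · by_cases hlj : l = j
    · simp [hlj, Ne.symm hij, Equiv.swap_apply_right]; ring
    · simp [Equiv.swap_apply_of_ne_of_ne hli hlj, hli, hlj]

/-- The reflection in the anti-diagonal mirror `x_i = -x_j` (normal `e_i + e_j`, `i ≠ j`) is the
signed transposition `x_i ↦ -x_j`, `x_j ↦ -x_i`, the reflection `(i, -j)(-i, j)` of the
hyperoctahedral group. [cite: BjornerBrenti2005, §8.1, Prop. 8.1.5] -/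
theorem reflection_single_add_single_apply {i j : ι} (hij : i ≠ j) (x : EuclideanSpace ℝ ι)
    (l : ι) :
    ((ℝ ∙ (EuclideanSpace.single i (1 : ℝ) + EuclideanSpace.single j 1))ᗮ.reflection x) l =
      if l = i then -x j else if l = j then -x i else x l := by
  have hn : ‖EuclideanSpace.single i (1 : ℝ) + EuclideanSpace.single j 1‖ ^ 2 = 2 := by
    rw [← real_inner_self_eq_norm_sq, inner_single_add_single_left]
    simp [hij, Ne.symm hij]; norm_num
  rw [Submodule.reflection_orthogonal_apply, Submodule.reflection_singleton_apply,
    inner_single_add_single_left]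
  simp only [RCLike.ofReal_real_eq_id, id_eq, hn, PiLp.neg_apply, PiLp.sub_apply, PiLp.add_apply,
    PiLp.smul_apply, PiLp.single_apply, smul_eq_mul, nsmul_eq_mul, Nat.cast_ofNat]
  by_cases hli : l = i
  · simp [hli, hij]; ring
  · by_cases hlj : l = j
    · simp [hlj, Ne.symm hij]; ring
    · simp [hli, hlj]

/-! ### Non-orthogonal normals span -/

/-- **For every `k ≠ 0` the lattice mirror normals not orthogonal to `k` span the whole space.**
If `k_i ≠ 0` the coordinate normal `e_i` is not orthogonal to `k`; if `k_i = 0` then `k_j ≠ 0` for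
some `j ≠ i`, both `e_i + e_j` and `e_i - e_j` have inner product `± k_j ≠ 0` with `k`, and
`e_i = ½ ((e_i + e_j) + (e_i - e_j))`. (The combinatorial input of the LOCAL step of route
HyperoctahedralRP; false for the coordinate normals alone.) [folklore] -/
theorem span_latticeMirrorNormals_inner_ne_zero [Nontrivial ι] {k : EuclideanSpace ℝ ι}
    (hk : k ≠ 0) :
    Submodule.span ℝ {n ∈ latticeMirrorNormals ι | ⟪n, k⟫_ℝ ≠ 0} = ⊤ := by
  set S := Submodule.span ℝ {n ∈ latticeMirrorNormals ι | ⟪n, k⟫_ℝ ≠ 0} with hS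
  have hmem : ∀ n, n ∈ latticeMirrorNormals ι → ⟪n, k⟫_ℝ ≠ 0 → n ∈ S := fun n hn hnk =>
    Submodule.subset_span ⟨hn, hnk⟩
  obtain ⟨j, hj⟩ : ∃ j, k j ≠ 0 := by
    by_contra h
    push Not at h
    exact hk (PiLp.ext fun i => by simpa using h i)
  have he : ∀ i, EuclideanSpace.single i (1 : ℝ) ∈ S := by
    intro i
    by_cases hi : k i = 0
    · have hij : i ≠ j := fun h => hj (h ▸ hi)
      have h1 : EuclideanSpace.single i (1 : ℝ) + EuclideanSpace.single j 1 ∈ S :=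
        hmem _ (single_add_single_mem_latticeMirrorNormals hij)
          (by rw [inner_single_add_single_left, hi, zero_add]; exact hj)
      have h2 : EuclideanSpace.single i (1 : ℝ) - EuclideanSpace.single j 1 ∈ S :=
        hmem _ (single_sub_single_mem_latticeMirrorNormals hij)
          (by rw [inner_single_sub_single_left, hi, zero_sub]; exact neg_ne_zero.2 hj)
      have h3 : EuclideanSpace.single i (1 : ℝ) = (1 / 2 : ℝ) •
          ((EuclideanSpace.single i (1 : ℝ) + EuclideanSpace.single j 1) +
            (EuclideanSpace.single i (1 : ℝ) - EuclideanSpace.single j 1)) := by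
        module
      rw [h3]
      exact S.smul_mem _ (S.add_mem h1 h2)
    · obtain ⟨j', hj'⟩ := exists_ne i
      exact hmem _ (single_mem_latticeMirrorNormals hj'.symm) (by rwa [inner_single_one_left])
  rw [eq_top_iff, ← (EuclideanSpace.basisFun ι ℝ).toBasis.span_eq, Submodule.span_le]
  rintro _ ⟨i, rfl⟩
  simpa using he i

end Literature.MathematicalPhysics.QuantumFieldTheory
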